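import Summits.ABC.IUTFork.Conditional.AbcOfSGenuine
import Summits.ABC.ABC.Theorems.IUTThetaPilotThetaPartIIULineCapstone
import HarnessLib

/-!
# Branch C certificate AT THE GENUINE SETTING with the index-bijection binder `hplaces` DELETED — `cor312Of_of_SH_genuine_places`,
# `abc_of_S_v3_places` (CONE `hvol`), `abc_of_S_v4_places` (CONE `hreg`)

C scoreboard (this file): apex explicit 2 (S_H-bundle `H` WITHOUT the `hplaces` conjunct · CONE `hvol` resp. `hreg`) / EFFECTIVE 2; per datum
(`cor312Of_of_SH_genuine_places`): S_H 1 · PIN 1 (+ idele side 5) · FACT 0 · CONE 0 · READ 3 (`hI`, `hX`, `hΘ`) = 10 named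
(reference: `Conditional/AbcOfSGenuine.lean` v3 `cor312Of_of_SH_genuine`, abc-iut-C-cert-2 p430884: 11 named, the eleventh being `hplaces`).

PROOF-ONLY companion (no `def`, no new `Prop`; R2 S-CHAIN TEAM seat abc-iut-s2-p11, minted target «hplaces», CLAIM on HOME/STATUS.md
2026-08-26T08:2xZ «hplaces-COMPLEMENT»; the characterisation of `hplaces` as typed — it holds iff no place of `𝕍^bad_mod` has two places of
`F` above it — is abc-iut-w4-d054's `Cor312ProvenancePlaces.lean`, not restated here). WHAT THIS FILE RECORDS, kernel-side:

**the binder `hplaces : ∃ e : (thetaIndex X).V ≃ D.V, ∀ v, v ∈ (thetaIndex X).Vbad ↔ ((e v : D.V) : Val K) ∈ D.Vbad` of v3's per-datum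
certificate is IDLE for its conclusion `I.Cor312Of`.** In v3 it serves only to inhabit abc-iut-c312-8's provenance structure
`Cor312Prov.IsSettingOf D P` (field `places`), of which the bridge `Cor312Prov.cor312Of_of_statement_of_links` consumes the single field
`negLogQ_eq` (the `q`-NUMBER identity) — and that field is abc-iut-c312-7's THEOREM `negLogQ_settingPrVolSharp_eq_neg_absLogq` at the genuine
setting. Reading the `q`-side through that theorem and abc-iut-c312-8's `negAbsLogQ_eq_neg_absLogq_of_isVolumeInputOf` directly (exactly
the proof term of abc-iut-C-cert-3's `Shrink3.cor312Of_of_SH`, `Conditional/AbcOfSShrink3.lean` p431459, whose binder list is v3's minus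
`hplaces`; re-derived here over v3's imports only) gives:

* `cor312Of_of_SH_genuine_places` — v3's `cor312Of_of_SH_genuine` with the binder `hplaces` deleted, every other binder byte-identical;
* `abc_of_S_v3_places` — v3's apex `abc_of_S_v3` with the conjunct `∃ e : (thetaIndex X).V ≃ T.D.V, …` deleted from the S_H-bundle `H`
  (CONE binder `hvol` verbatim; downstream BY NAME abc-iut-S2 `ABC_of_cor312_of_hullVolume_of_genEllTwo` + abc-iut-S6 `genEllTwo_holds`);
* `abc_of_S_v4_places` — abc-iut-C-cert-1's apex `abc_of_S_v4` (`Conditional/AbcOfSGenuineRegime.lean` p431657: CONE binder `hreg` = the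
  hull estimate ONLY at non-slot-constant data, downstream BY NAME abc-iut-c312-8 `ThetaPartII.ABC_of_cor312_of_hullRegime` p428563) with the
  same conjunct deleted.
Since `H_v3 ⟹ H_places` (drop one component of the witness tuple), v3 / v4 are COROLLARIES of the `_places` forms: a strict weakening of
the hypothesis list by deletion, no trade, no new binder.

WHY IT MATTERS (bookkeeping, not mathematics): `(thetaIndex X).V = 𝕍(F)` (all places of `F`, abc-iut-c312-5 `Thm311.Real.thetaIndex`) while
`D.V = V̲ ≅ V_mod` ([IUTchI] Def. 3.1 (e), abc-iut-L5-t2 `InitialThetaData.V_bijOn`); under `IsPilotDataOf D X` the bad index set is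
`S = 𝕍(F)^bad := 𝕍^bad_mod ×_{𝕍_mod} 𝕍(F)` ([IUTchIV] Thm. 1.10 p. 23), which maps ONTO `V̲^bad ≅ 𝕍^bad_mod` — a SURJECTION («the natural
surjection `V(K) ↠ V_mod`», Def. 3.1 (e)), a bijection only when no bad place of `F_mod` splits in `F`. So at every genuine Θ-volume
datum `T` whose field `F` has two places over one place of `𝕍^bad_mod` the conjunct `hplaces` is FALSE and the S_H-bundle `H` of v3 / v4 is
unsatisfiable at `(P₀, l, T)` for a reason without arithmetic content; the `_places` forms are free of it. (The natural projection
`𝕍(F) ↠ V̲` with `𝕍(F)^bad` the preimage of `V̲^bad` is recorded as a theorem in `Summits/ABC/IUTFork/Cor312ProvenancePlacesOver.lean`.)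

HONEST FRAMING: this campaign LOCATES / CONDITIONALLY VERIFIES. Nothing here asserts that abc is proved or refuted, or that [IUTchIII]
Cor. 3.12 holds or fails at any datum, or takes a side on any author (Mochizuki / Scholze–Stix / Joshi / Dupuy–Hilado); statements about OUR
typed objects; «`ABC` follows from S_H + the listed hypotheses AS TYPED», nothing more; S_H (`PilotKummerCompatHull` at the genuine setting)
IS the disputed (xi-f) inclusion and stays an assumption label; a deleted idle binder asserts nothing; typed ≠ proved.
[claim: Mochizuki2012, status: disputed] [cite: Mochizuki2012, IUTchI Def. 3.1 (e) p. 61; IUTchIV Thm. 1.10 p. 23] [cite: DupuyHilado2025, §3.3]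
-/

noncomputable section

namespace Summit.ABC.IUTFork.Conditional

open Thm311 Thm311.Real Cor312 Cor312Vol Cor312Prov
open Literature.IUT.LogThetaLattice Literature.IUT.LogVolume Literature.IUT.HodgeTheaters
open Literature.NumberTheory.DiophantineGeometry.GenEll NumberField IsDedekindDomain

/-- **Per-datum certificate at the GENUINE setting, HULL-LEVEL form S_H, WITHOUT the index-bijection binder.** Binders = those of
abc-iut-C-cert-2's `cor312Of_of_SH_genuine` (v3, p430884) with `hplaces` DELETED, byte-identical otherwise: genuine Θ-data `D`, volume input
`I`, pilot data `X` with the setting data of abc-iut-c312-7's print-normalised assembled real setting `Real.settingPrVolSharp` over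
abc-iut-c312-5's `LatticeSituation.ofShells`; [SIDE] `htq0 htq1 htq ht0 ht1`; [READ] `hI`, `hX`, `hΘ` (one-sided Θ-identification, OPEN);
[S_H] `hSH` (abc-iut-w5-d068 `PilotKummerCompatHull` — the disputed (xi-f) inclusion at the genuine setting, an assumption label); [PIN] `hQPin`.
Route BY NAME: `bridgeHyps_settingPrVolSharp_of_ideles` + `statement_of_pilotKummerCompatHull` ⟹ the verbatim `Statement`; q-side
`negLogQ_settingPrVolSharp_eq_neg_absLogq` ∘ `negAbsLogQ_eq_neg_absLogq_of_isVolumeInputOf` (no `IsSettingOf`, hence no `places`); Θ-side `hΘ`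
— the proof term of abc-iut-C-cert-3's `Shrink3.cor312Of_of_SH`. «`I.Cor312Of` follows from S_H + these hypotheses as typed», nothing more;
no side taken. [claim: Mochizuki2012, status: disputed] -/
theorem cor312Of_of_SH_genuine_places
    -- the genuine Θ-data and its volume input
    {F K Fbar : Type} [Field F] [NumberField F] [Field K] [NumberField K] [Algebra F K] [Field Fbar] [Algebra F Fbar]
    [Algebra K Fbar] {E : WeierstrassCurve F} [E.IsElliptic] {l : ℕ} {Pb : BadPlacePredicates K}
    (D : InitialThetaData F K Fbar E l Pb) (I : ThetaVolumeInput (fieldOfModuli E) K)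
    -- Dupuy–Hilado pilot data over F and the data of the print-normalised assembled real setting (abc-iut-c312-7's binders)
    (X : PilotData F) (M : Type) [Field M] [NumberField M]
    (archPk : ∀ (j : (thetaIndex X).Label) (vQ : (thetaIndex X).VQ), Set ((logShellsDH X (analyticLogv F)).Packet j vQ))
    (archSub : ∀ (j : (thetaIndex X).Label) (v : (thetaIndex X).V),
      Set ((logShellsDH X (analyticLogv F)).Packet j ((thetaIndex X).over v)))
    (Ψ : ℤ → ∀ v : (thetaIndex X).V, v ∈ (thetaIndex X).Vbad → Set ((logShellsDH X (analyticLogv F)).StarPacket v))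
    (act : ℤ → ∀ v : (thetaIndex X).V, v ∈ (thetaIndex X).Vbad →
      (logShellsDH X (analyticLogv F)).StarPacket v → Module.End ℚ ((logShellsDH X (analyticLogv F)).StarPacket v))
    (Mmod : ℤ → ∀ j : (thetaIndex X).LabelStar, Set ((logShellsDH X (analyticLogv F)).GlobalPacket j.1))
    (region : ℤ → ∀ j : (thetaIndex X).LabelStar, FinDivisor M → ∀ vQ : (thetaIndex X).VQ,
      Set ((logShellsDH X (analyticLogv F)).Packet j.1 vQ))
    -- the Frobenius-like column binders of abc-iut-c312-5's `LatticeSituation.ofShells`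
    (frobAdm : ℤ → ℤ → ∀ (j : (thetaIndex X).Label) (vQ : (thetaIndex X).VQ),
      Set ((logShellsDH X (analyticLogv F)).Packet j vQ) → Prop)
    (frobLogvol : ℤ → ℤ → ∀ (j : (thetaIndex X).Label) (vQ : (thetaIndex X).VQ),
      Set ((logShellsDH X (analyticLogv F)).Packet j vQ) → ℝ)
    (frobΨ : ℤ → ℤ → ∀ v : (thetaIndex X).V, v ∈ (thetaIndex X).Vbad → Set ((logShellsDH X (analyticLogv F)).StarPacket v))
    (frobMmod : ℤ → ℤ → ∀ j : (thetaIndex X).LabelStar, Set ((logShellsDH X (analyticLogv F)).GlobalPacket j.1))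
    (unitImage : ℤ → ℤ → ℕ → ∀ (j : (thetaIndex X).Label) (vQ : (thetaIndex X).VQ),
      Set ((logShellsDH X (analyticLogv F)).Packet j vQ))
    (ballImage : ℤ → ℤ → ∀ (j : (thetaIndex X).Label) (vQ : (thetaIndex X).VQ),
      Set ((logShellsDH X (analyticLogv F)).Packet j vQ))
    (thetaDiv : ℤ → ℤ → LgpDivisor M (thetaIndex X).lstar)
    (n : ℤ) {HT : Type} {LogLink : HT → HT → Type} {IsFull : ∀ {s t : HT}, LogLink s t → Prop}
    (lat : LGPGaussianLogThetaLattice LogLink IsFull)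
    {Frd : Type} {IsoF : Frd → Frd → Type} {Ob : Frd → Type} {realify : Frd → Frd} {Strip : Type}
    {IsoS : Strip → Strip → Type} {Mv : ∀ v : (thetaIndex X).V, v ∈ (thetaIndex X).Vbad → Type}
    [∀ v h, Monoid (Mv v h)]
    (sig : GlobalLGPFrobenioidSignature (thetaIndex X).lstar (thetaIndex X).V (· ∈ (thetaIndex X).Vbad)
      Frd IsoF Ob realify Strip IsoS Mv)
    (split : SplittingMonoids Mv) {ObΔ : Type} {N : ∀ v : (thetaIndex X).V, v ∈ (thetaIndex X).Vbad → Type}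
    [∀ v h, Monoid (N v h)] (qData : QPilotData ObΔ N)
    -- the ideles: q-pilot `tq` and Θ-pilot `t`
    (tq : ∀ (pp : Nat.Primes) (x : (thetaIndex X).Fibre (.inr pp)), haveI : Fact (pp : ℕ).Prime := ⟨pp.2⟩; kOf X pp.1 x)
    (t : ∀ (pp : Nat.Primes) (_ : Fin X.lstar) (x : (thetaIndex X).Fibre (.inr pp)),
      haveI : Fact (pp : ℕ).Prime := ⟨pp.2⟩; kOf X pp.1 x)
    -- PR-1's region reading and q-pilot Kummer datum on the real star packets
    (ρ : (∀ v : (thetaIndex X).V, v ∈ (thetaIndex X).Vbad → Set ((logShellsDH X (analyticLogv F)).StarPacket v)) →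
      ∀ (j : (thetaIndex X).Label) (vQ : (thetaIndex X).VQ), Set ((logShellsDH X (analyticLogv F)).Packet j vQ))
    (qK : ∀ v : (thetaIndex X).V, v ∈ (thetaIndex X).Vbad → Set ((logShellsDH X (analyticLogv F)).StarPacket v))
    -- [PIN-side] idele side conditions (non-zero; units off S; `tq` realises P_q in Dupuy–Hilado's normalisation (3.4))
    (htq0 : ∀ pp x, tq pp x ≠ 0)
    (htq1 : ∀ (pp : Nat.Primes) (x : (thetaIndex X).Fibre (.inr pp)),
      haveI : Fact (pp : ℕ).Prime := ⟨pp.2⟩; placeOf X pp.1 x ∉ X.S → ‖tq pp x‖ = 1)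
    (htq : ∀ (pp : Nat.Primes) (x : (thetaIndex X).Fibre (.inr pp)),
      haveI : Fact (pp : ℕ).Prime := ⟨pp.2⟩
      Real.log ‖tq pp x‖ = -(X.qPilot (placeOf X pp.1 x)) * logNorm F (placeOf X pp.1 x) /
        localDegree F (placeOf X pp.1 x))
    (ht0 : ∀ pp i x, t pp i x ≠ 0)
    (ht1 : ∀ (pp : Nat.Primes) (i : Fin X.lstar) (x : (thetaIndex X).Fibre (.inr pp)),
      haveI : Fact (pp : ℕ).Prime := ⟨pp.2⟩; placeOf X pp.1 x ∉ X.S → ‖t pp i x‖ = 1)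
    -- [READ] provenance: `I` is a volume input OF `D`, `X` is the pilot data OF `D` (NO index bijection)
    (hI : ThetaData.IsVolumeInputOf D I) (hX : IsPilotDataOf D X)
    -- [S_H] the HULL-LEVEL printed clause at the genuine setting: the ρ-region of the q-pilot's Kummer datum lies in the Θ-hull
    (hSH : Cor312Vol.PilotKummerCompatHull
      (LatticeSituation.ofShells (logShellsDH X (analyticLogv F)) M archPk archSub
        (summandPiecesPr X (logvAnalytic_analyticLogv (F := F))).Adm
        (summandPiecesPr X (logvAnalytic_analyticLogv (F := F))).logvol Ψ act Mmod region
        frobAdm frobLogvol frobΨ frobMmod unitImage ballImage thetaDiv)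
      (settingPrVolSharp X (logvAnalytic_analyticLogv (F := F)) M archPk archSub Ψ act Mmod region n lat sig split qData
        tq t htq0 htq1) ρ qK)
    -- [PIN] the q-pin ALONE at the genuine setting
    (hQPin : Cor312Vol.QPinned
      (LatticeSituation.ofShells (logShellsDH X (analyticLogv F)) M archPk archSub
        (summandPiecesPr X (logvAnalytic_analyticLogv (F := F))).Adm
        (summandPiecesPr X (logvAnalytic_analyticLogv (F := F))).logvol Ψ act Mmod region
        frobAdm frobLogvol frobΨ frobMmod unitImage ballImage thetaDiv)
      (settingPrVolSharp X (logvAnalytic_analyticLogv (F := F)) M archPk archSub Ψ act Mmod region n lat sig split qData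
        tq t htq0 htq1) ρ qK)
    -- [READ] the one-sided Θ-identification (OPEN, C312-RESIDUALS §1a′)
    (hΘ : (settingPrVolSharp X (logvAnalytic_analyticLogv (F := F)) M archPk archSub Ψ act Mmod region n lat sig split qData
        tq t htq0 htq1).negLogTheta ≤ ((I.negLogTheta : ℝ) : WithTop ℝ)) :
    I.Cor312Of := by
  -- the verbatim Statement at the genuine setting on the hull-level line: `BridgeHyps` is c312-7's THEOREM, no Theorem 3.11 input
  have hst : (settingPrVolSharp X (logvAnalytic_analyticLogv (F := F)) M archPk archSub Ψ act Mmod region n lat sig split qData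
      tq t htq0 htq1).Statement :=
    Cor312Vol.statement_of_pilotKummerCompatHull
      (LatticeSituation.ofShells (logShellsDH X (analyticLogv F)) M archPk archSub
        (summandPiecesPr X (logvAnalytic_analyticLogv (F := F))).Adm
        (summandPiecesPr X (logvAnalytic_analyticLogv (F := F))).logvol Ψ act Mmod region
        frobAdm frobLogvol frobΨ frobMmod unitImage ballImage thetaDiv)
      (settingPrVolSharp X (logvAnalytic_analyticLogv (F := F)) M archPk archSub Ψ act Mmod region n lat sig split qData
        tq t htq0 htq1) ρ qK
      (bridgeHyps_settingPrVolSharp_of_ideles X (logvAnalytic_analyticLogv (F := F)) M archPk archSub Ψ act Mmod region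
        n lat sig split qData t tq ht0 ht1 htq0 htq1) hQPin hSH
  -- the q-side by c312-7's q-number THEOREM (the only field of `IsSettingOf` the bridge consumes) — no index bijection needed
  have hq := negLogQ_settingPrVolSharp_eq_neg_absLogq X (logvAnalytic_analyticLogv (F := F)) M archPk archSub Ψ act
    Mmod region n lat sig split qData t tq hX htq0 htq1 htq
  obtain ⟨-, hle⟩ := hst
  rw [hq] at hle
  -- the Θ-side by the one-sided identification `hΘ`
  show I.negAbsLogQ ≤ I.negLogTheta
  rw [Cor312Prov.negAbsLogQ_eq_neg_absLogq_of_isVolumeInputOf D hI]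
  exact WithTop.coe_le_coe.mp (hle.trans hΘ)


/-- **`abc_of_S_v3_places` — abc-iut-C-cert-2's `abc_of_S_v3` (p430884) with the index-bijection conjunct deleted from the S_H-bundle.**
HYPOTHESES: [S_H-bundle at the genuine setting] `H` — for every admissible `(λ, l)` (`Cor22.Thm110Legendre` binders) and genuine Θ-volume
datum `T` THERE ARE setting data (pilot data `X` OF `T.D`, auxiliary field `M`, archimedean/(b)(c) data, column binders, lattice /
Frobenioid / pilot context, ideles `t`, `tq`, PR-1's `ρ`, `qK`) with the idele side conditions, `IsPilotDataOf`, the hull-level printed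
clause `PilotKummerCompatHull`, the q-pin and the ONE-SIDED Θ-identification — v3's list WITHOUT `∃ e : (thetaIndex X).V ≃ T.D.V, …`;
[CONE, layer S] `hvol` — the route's child (ii′) with print's `B_III(λ, l)`, verbatim as in v3. Downstream BY NAME and hypothesis-free:
abc-iut-S2 `ABC_of_cor312_of_hullVolume_of_genEllTwo` (p424478) and abc-iut-S6 `genEllTwo_holds` (p422748). `abc_of_S_v3` is the corollary
obtained by forgetting the extra witness component. «`ABC` follows from S_H + these hypotheses as typed», nothing more; no side taken on
[IUTchIII] Cor. 3.12 or on any author; typed ≠ proved. [claim: Mochizuki2012, status: disputed] -/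
theorem abc_of_S_v3_places
    (H : ∀ P₀ : NFPoint, P₀ ∈ UP → ∀ l : ℕ, l.Prime → 5 ≤ l →
      Cor22.AdmitsCore P₀ → Cor22.CondP2 P₀ l → Cor22.CondP5 P₀ l → Cor22.CondP6 P₀ l →
      ∀ T : Cor22.ThetaVolumeDatumAt P₀ l,
        letI := T.instFieldF; letI := T.instNumberFieldF; letI := T.instFieldK; letI := T.instNumberFieldK
        letI := T.instAlgebraK; letI := T.instFieldFbar; letI := T.instAlgebraFbar; letI := T.instAlgebraKFbar
        letI := T.instIsElliptic
        ∃ (X : PilotData T.F) (M : Type) (_ : Field M) (_ : NumberField M)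
          (archPk : ∀ (j : (thetaIndex X).Label) (vQ : (thetaIndex X).VQ), Set ((logShellsDH X (analyticLogv T.F)).Packet j vQ))
          (archSub : ∀ (j : (thetaIndex X).Label) (v : (thetaIndex X).V),
            Set ((logShellsDH X (analyticLogv T.F)).Packet j ((thetaIndex X).over v)))
          (Ψ : ℤ → ∀ v : (thetaIndex X).V, v ∈ (thetaIndex X).Vbad → Set ((logShellsDH X (analyticLogv T.F)).StarPacket v))
          (act : ℤ → ∀ v : (thetaIndex X).V, v ∈ (thetaIndex X).Vbad →
            (logShellsDH X (analyticLogv T.F)).StarPacket v → Module.End ℚ ((logShellsDH X (analyticLogv T.F)).StarPacket v))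
          (Mmod : ℤ → ∀ j : (thetaIndex X).LabelStar, Set ((logShellsDH X (analyticLogv T.F)).GlobalPacket j.1))
          (region : ℤ → ∀ j : (thetaIndex X).LabelStar, FinDivisor M → ∀ vQ : (thetaIndex X).VQ,
            Set ((logShellsDH X (analyticLogv T.F)).Packet j.1 vQ))
          (frobAdm : ℤ → ℤ → ∀ (j : (thetaIndex X).Label) (vQ : (thetaIndex X).VQ),
            Set ((logShellsDH X (analyticLogv T.F)).Packet j vQ) → Prop)
          (frobLogvol : ℤ → ℤ → ∀ (j : (thetaIndex X).Label) (vQ : (thetaIndex X).VQ),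
            Set ((logShellsDH X (analyticLogv T.F)).Packet j vQ) → ℝ)
          (frobΨ : ℤ → ℤ → ∀ v : (thetaIndex X).V, v ∈ (thetaIndex X).Vbad →
            Set ((logShellsDH X (analyticLogv T.F)).StarPacket v))
          (frobMmod : ℤ → ℤ → ∀ j : (thetaIndex X).LabelStar, Set ((logShellsDH X (analyticLogv T.F)).GlobalPacket j.1))
          (unitImage : ℤ → ℤ → ℕ → ∀ (j : (thetaIndex X).Label) (vQ : (thetaIndex X).VQ),
            Set ((logShellsDH X (analyticLogv T.F)).Packet j vQ))
          (ballImage : ℤ → ℤ → ∀ (j : (thetaIndex X).Label) (vQ : (thetaIndex X).VQ),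
            Set ((logShellsDH X (analyticLogv T.F)).Packet j vQ))
          (thetaDiv : ℤ → ℤ → LgpDivisor M (thetaIndex X).lstar)
          (n : ℤ) (HT : Type) (LogLink : HT → HT → Type) (IsFull : ∀ {s t : HT}, LogLink s t → Prop)
          (lat : LGPGaussianLogThetaLattice LogLink IsFull)
          (Frd : Type) (IsoF : Frd → Frd → Type) (Ob : Frd → Type) (realify : Frd → Frd) (Strip : Type)
          (IsoS : Strip → Strip → Type) (Mv : ∀ v : (thetaIndex X).V, v ∈ (thetaIndex X).Vbad → Type)
          (_ : ∀ v h, Monoid (Mv v h))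
          (sig : GlobalLGPFrobenioidSignature (thetaIndex X).lstar (thetaIndex X).V (· ∈ (thetaIndex X).Vbad)
            Frd IsoF Ob realify Strip IsoS Mv)
          (split : SplittingMonoids Mv) (ObΔ : Type) (N : ∀ v : (thetaIndex X).V, v ∈ (thetaIndex X).Vbad → Type)
          (_ : ∀ v h, Monoid (N v h)) (qData : QPilotData ObΔ N)
          (tq : ∀ (pp : Nat.Primes) (x : (thetaIndex X).Fibre (.inr pp)), haveI : Fact (pp : ℕ).Prime := ⟨pp.2⟩; kOf X pp.1 x)
          (t : ∀ (pp : Nat.Primes) (_ : Fin X.lstar) (x : (thetaIndex X).Fibre (.inr pp)),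
            haveI : Fact (pp : ℕ).Prime := ⟨pp.2⟩; kOf X pp.1 x)
          (ρ : (∀ v : (thetaIndex X).V, v ∈ (thetaIndex X).Vbad → Set ((logShellsDH X (analyticLogv T.F)).StarPacket v)) →
            ∀ (j : (thetaIndex X).Label) (vQ : (thetaIndex X).VQ), Set ((logShellsDH X (analyticLogv T.F)).Packet j vQ))
          (qK : ∀ v : (thetaIndex X).V, v ∈ (thetaIndex X).Vbad → Set ((logShellsDH X (analyticLogv T.F)).StarPacket v))
          (htq0 : ∀ pp x, tq pp x ≠ 0)
          (htq1 : ∀ (pp : Nat.Primes) (x : (thetaIndex X).Fibre (.inr pp)),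
            haveI : Fact (pp : ℕ).Prime := ⟨pp.2⟩; placeOf X pp.1 x ∉ X.S → ‖tq pp x‖ = 1)
          (_ : ∀ (pp : Nat.Primes) (x : (thetaIndex X).Fibre (.inr pp)),
            haveI : Fact (pp : ℕ).Prime := ⟨pp.2⟩
            Real.log ‖tq pp x‖ = -(X.qPilot (placeOf X pp.1 x)) * logNorm T.F (placeOf X pp.1 x) /
              localDegree T.F (placeOf X pp.1 x))
          (_ : ∀ pp i x, t pp i x ≠ 0)
          (_ : ∀ (pp : Nat.Primes) (i : Fin X.lstar) (x : (thetaIndex X).Fibre (.inr pp)),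
            haveI : Fact (pp : ℕ).Prime := ⟨pp.2⟩; placeOf X pp.1 x ∉ X.S → ‖t pp i x‖ = 1)
          (_ : IsPilotDataOf T.D X),
          Cor312Vol.PilotKummerCompatHull
              (LatticeSituation.ofShells (logShellsDH X (analyticLogv T.F)) M archPk archSub
                (summandPiecesPr X (logvAnalytic_analyticLogv (F := T.F))).Adm
                (summandPiecesPr X (logvAnalytic_analyticLogv (F := T.F))).logvol Ψ act Mmod region
                frobAdm frobLogvol frobΨ frobMmod unitImage ballImage thetaDiv)
              (settingPrVolSharp X (logvAnalytic_analyticLogv (F := T.F)) M archPk archSub Ψ act Mmod region n lat sig split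
                qData tq t htq0 htq1) ρ qK ∧
            Cor312Vol.QPinned
              (LatticeSituation.ofShells (logShellsDH X (analyticLogv T.F)) M archPk archSub
                (summandPiecesPr X (logvAnalytic_analyticLogv (F := T.F))).Adm
                (summandPiecesPr X (logvAnalytic_analyticLogv (F := T.F))).logvol Ψ act Mmod region
                frobAdm frobLogvol frobΨ frobMmod unitImage ballImage thetaDiv)
              (settingPrVolSharp X (logvAnalytic_analyticLogv (F := T.F)) M archPk archSub Ψ act Mmod region n lat sig split
                qData tq t htq0 htq1) ρ qK ∧
            (settingPrVolSharp X (logvAnalytic_analyticLogv (F := T.F)) M archPk archSub Ψ act Mmod region n lat sig split qData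
                tq t htq0 htq1).negLogTheta ≤ ((T.negLogTheta : ℝ) : WithTop ℝ))
    -- [CONE, layer S] the computable half (ii′) with print's B_III(λ, l)
    (hvol : ∀ P₀ : NFPoint, P₀ ∈ UP → ∀ l : ℕ, l.Prime → 5 ≤ l →
      Cor22.AdmitsCore P₀ → Cor22.CondP2 P₀ l → Cor22.CondP5 P₀ l → Cor22.CondP6 P₀ l →
        Cor22.HullVolumeAtDatum P₀ l (((l : ℝ) + 1) / 4 *
          ((1 + 12 * (Cor22.dmod P₀ : ℝ) / l) * (P₀.logDiff + Cor22.logCondAvoid P₀ {2, l})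
            + 2 * Real.log l + 52
            + 20 / 3 * Real.log (((2 ^ 12 * 3 ^ 3 * 5 * Cor22.dmod P₀ : ℕ) : ℝ) * (l : ℝ))
              * (Nat.primeCounting (2 ^ 12 * 3 ^ 3 * 5 * Cor22.dmod P₀ * l) : ℝ)))) :
    _root_.ABC := by
  refine Summit.ABC.ABC.Theorems.ABC_of_cor312_of_hullVolume_of_genEllTwo (fun P₀ hP l hl h5 hc h2 h5' h6 => ?_) hvol
    Summit.ABC.ABC.Theorems.genEllTwo_holds
  intro T
  letI := T.instFieldF; letI := T.instNumberFieldF; letI := T.instFieldK; letI := T.instNumberFieldK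
  letI := T.instAlgebraK; letI := T.instFieldFbar; letI := T.instAlgebraFbar; letI := T.instAlgebraKFbar
  letI := T.instIsElliptic
  obtain ⟨X, M, _, _, archPk, archSub, Ψ, act, Mmod, region, frobAdm, frobLogvol, frobΨ, frobMmod, unitImage, ballImage,
    thetaDiv, n, HT, LogLink, IsFull, lat, Frd, IsoF, Ob, realify, Strip, IsoS, Mv, _, sig, split, ObΔ, N, _, qData, tq, t, ρ, qK,
    htq0, htq1, htq, ht0, ht1, hX, hSH, hQPin, hΘ⟩ := H P₀ hP l hl h5 hc h2 h5' h6 T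
  exact cor312Of_of_SH_genuine_places T.D T.I X M archPk archSub Ψ act Mmod region frobAdm frobLogvol frobΨ frobMmod unitImage
    ballImage thetaDiv n lat sig split qData tq t ρ qK htq0 htq1 htq ht0 ht1 T.isVolumeInputOf hX hSH hQPin hΘ


/-- **`abc_of_S_v4_places` — abc-iut-C-cert-1's `abc_of_S_v4` (p431657, the C lead's line of record since C-R13) with the index-bijection
conjunct deleted from the S_H-bundle.** [S_H-bundle] `H` as in `abc_of_S_v3_places`; [CONE, layer S] `hreg` — abc-iut-c312-8's
`stub_hullRegime` body verbatim as in v4: the hull estimate with print's `B_III(λ, l)` demanded ONLY at NON-slot-constant genuine data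
(slot-constant data, in particular `d_mod = 1`, PROVED inside the capstone). Downstream BY NAME:
`Summit.ABC.ABC.Theorems.ThetaPartII.ABC_of_cor312_of_hullRegime` (p428563). `abc_of_S_v4` is the corollary obtained by forgetting the extra
witness component. «`ABC` follows from S_H + these hypotheses as typed», nothing more; no side taken on [IUTchIII] Cor. 3.12, on (U)/(P), or
on any author; typed ≠ proved. [claim: Mochizuki2012, status: disputed] -/
theorem abc_of_S_v4_places
    (H : ∀ P₀ : NFPoint, P₀ ∈ UP → ∀ l : ℕ, l.Prime → 5 ≤ l →
      Cor22.AdmitsCore P₀ → Cor22.CondP2 P₀ l → Cor22.CondP5 P₀ l → Cor22.CondP6 P₀ l →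
      ∀ T : Cor22.ThetaVolumeDatumAt P₀ l,
        letI := T.instFieldF; letI := T.instNumberFieldF; letI := T.instFieldK; letI := T.instNumberFieldK
        letI := T.instAlgebraK; letI := T.instFieldFbar; letI := T.instAlgebraFbar; letI := T.instAlgebraKFbar
        letI := T.instIsElliptic
        ∃ (X : PilotData T.F) (M : Type) (_ : Field M) (_ : NumberField M)
          (archPk : ∀ (j : (thetaIndex X).Label) (vQ : (thetaIndex X).VQ), Set ((logShellsDH X (analyticLogv T.F)).Packet j vQ))
          (archSub : ∀ (j : (thetaIndex X).Label) (v : (thetaIndex X).V),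
            Set ((logShellsDH X (analyticLogv T.F)).Packet j ((thetaIndex X).over v)))
          (Ψ : ℤ → ∀ v : (thetaIndex X).V, v ∈ (thetaIndex X).Vbad → Set ((logShellsDH X (analyticLogv T.F)).StarPacket v))
          (act : ℤ → ∀ v : (thetaIndex X).V, v ∈ (thetaIndex X).Vbad →
            (logShellsDH X (analyticLogv T.F)).StarPacket v → Module.End ℚ ((logShellsDH X (analyticLogv T.F)).StarPacket v))
          (Mmod : ℤ → ∀ j : (thetaIndex X).LabelStar, Set ((logShellsDH X (analyticLogv T.F)).GlobalPacket j.1))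
          (region : ℤ → ∀ j : (thetaIndex X).LabelStar, FinDivisor M → ∀ vQ : (thetaIndex X).VQ,
            Set ((logShellsDH X (analyticLogv T.F)).Packet j.1 vQ))
          (frobAdm : ℤ → ℤ → ∀ (j : (thetaIndex X).Label) (vQ : (thetaIndex X).VQ),
            Set ((logShellsDH X (analyticLogv T.F)).Packet j vQ) → Prop)
          (frobLogvol : ℤ → ℤ → ∀ (j : (thetaIndex X).Label) (vQ : (thetaIndex X).VQ),
            Set ((logShellsDH X (analyticLogv T.F)).Packet j vQ) → ℝ)
          (frobΨ : ℤ → ℤ → ∀ v : (thetaIndex X).V, v ∈ (thetaIndex X).Vbad →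
            Set ((logShellsDH X (analyticLogv T.F)).StarPacket v))
          (frobMmod : ℤ → ℤ → ∀ j : (thetaIndex X).LabelStar, Set ((logShellsDH X (analyticLogv T.F)).GlobalPacket j.1))
          (unitImage : ℤ → ℤ → ℕ → ∀ (j : (thetaIndex X).Label) (vQ : (thetaIndex X).VQ),
            Set ((logShellsDH X (analyticLogv T.F)).Packet j vQ))
          (ballImage : ℤ → ℤ → ∀ (j : (thetaIndex X).Label) (vQ : (thetaIndex X).VQ),
            Set ((logShellsDH X (analyticLogv T.F)).Packet j vQ))
          (thetaDiv : ℤ → ℤ → LgpDivisor M (thetaIndex X).lstar)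
          (n : ℤ) (HT : Type) (LogLink : HT → HT → Type) (IsFull : ∀ {s t : HT}, LogLink s t → Prop)
          (lat : LGPGaussianLogThetaLattice LogLink IsFull)
          (Frd : Type) (IsoF : Frd → Frd → Type) (Ob : Frd → Type) (realify : Frd → Frd) (Strip : Type)
          (IsoS : Strip → Strip → Type) (Mv : ∀ v : (thetaIndex X).V, v ∈ (thetaIndex X).Vbad → Type)
          (_ : ∀ v h, Monoid (Mv v h))
          (sig : GlobalLGPFrobenioidSignature (thetaIndex X).lstar (thetaIndex X).V (· ∈ (thetaIndex X).Vbad)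
            Frd IsoF Ob realify Strip IsoS Mv)
          (split : SplittingMonoids Mv) (ObΔ : Type) (N : ∀ v : (thetaIndex X).V, v ∈ (thetaIndex X).Vbad → Type)
          (_ : ∀ v h, Monoid (N v h)) (qData : QPilotData ObΔ N)
          (tq : ∀ (pp : Nat.Primes) (x : (thetaIndex X).Fibre (.inr pp)), haveI : Fact (pp : ℕ).Prime := ⟨pp.2⟩; kOf X pp.1 x)
          (t : ∀ (pp : Nat.Primes) (_ : Fin X.lstar) (x : (thetaIndex X).Fibre (.inr pp)),
            haveI : Fact (pp : ℕ).Prime := ⟨pp.2⟩; kOf X pp.1 x)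
          (ρ : (∀ v : (thetaIndex X).V, v ∈ (thetaIndex X).Vbad → Set ((logShellsDH X (analyticLogv T.F)).StarPacket v)) →
            ∀ (j : (thetaIndex X).Label) (vQ : (thetaIndex X).VQ), Set ((logShellsDH X (analyticLogv T.F)).Packet j vQ))
          (qK : ∀ v : (thetaIndex X).V, v ∈ (thetaIndex X).Vbad → Set ((logShellsDH X (analyticLogv T.F)).StarPacket v))
          (htq0 : ∀ pp x, tq pp x ≠ 0)
          (htq1 : ∀ (pp : Nat.Primes) (x : (thetaIndex X).Fibre (.inr pp)),
            haveI : Fact (pp : ℕ).Prime := ⟨pp.2⟩; placeOf X pp.1 x ∉ X.S → ‖tq pp x‖ = 1)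
          (_ : ∀ (pp : Nat.Primes) (x : (thetaIndex X).Fibre (.inr pp)),
            haveI : Fact (pp : ℕ).Prime := ⟨pp.2⟩
            Real.log ‖tq pp x‖ = -(X.qPilot (placeOf X pp.1 x)) * logNorm T.F (placeOf X pp.1 x) /
              localDegree T.F (placeOf X pp.1 x))
          (_ : ∀ pp i x, t pp i x ≠ 0)
          (_ : ∀ (pp : Nat.Primes) (i : Fin X.lstar) (x : (thetaIndex X).Fibre (.inr pp)),
            haveI : Fact (pp : ℕ).Prime := ⟨pp.2⟩; placeOf X pp.1 x ∉ X.S → ‖t pp i x‖ = 1)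
          (_ : IsPilotDataOf T.D X),
          Cor312Vol.PilotKummerCompatHull
              (LatticeSituation.ofShells (logShellsDH X (analyticLogv T.F)) M archPk archSub
                (summandPiecesPr X (logvAnalytic_analyticLogv (F := T.F))).Adm
                (summandPiecesPr X (logvAnalytic_analyticLogv (F := T.F))).logvol Ψ act Mmod region
                frobAdm frobLogvol frobΨ frobMmod unitImage ballImage thetaDiv)
              (settingPrVolSharp X (logvAnalytic_analyticLogv (F := T.F)) M archPk archSub Ψ act Mmod region n lat sig split
                qData tq t htq0 htq1) ρ qK ∧
            Cor312Vol.QPinned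
              (LatticeSituation.ofShells (logShellsDH X (analyticLogv T.F)) M archPk archSub
                (summandPiecesPr X (logvAnalytic_analyticLogv (F := T.F))).Adm
                (summandPiecesPr X (logvAnalytic_analyticLogv (F := T.F))).logvol Ψ act Mmod region
                frobAdm frobLogvol frobΨ frobMmod unitImage ballImage thetaDiv)
              (settingPrVolSharp X (logvAnalytic_analyticLogv (F := T.F)) M archPk archSub Ψ act Mmod region n lat sig split
                qData tq t htq0 htq1) ρ qK ∧
            (settingPrVolSharp X (logvAnalytic_analyticLogv (F := T.F)) M archPk archSub Ψ act Mmod region n lat sig split qData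
                tq t htq0 htq1).negLogTheta ≤ ((T.negLogTheta : ℝ) : WithTop ℝ))
    -- [CONE, layer S] the route's own open residue `stub_hullRegime` (RISK ¶7): the hull estimate with print's B_III(λ, l) is
    -- demanded ONLY at NON-slot-constant genuine data (slot-constant data, in particular d_mod = 1, are PROVED inside c312-8's capstone)
    (hreg : ∀ P : NFPoint, P ∈ UP → ∀ l : ℕ, l.Prime → 5 ≤ l →
      Cor22.AdmitsCore P → Cor22.CondP2 P l → Cor22.CondP5 P l → Cor22.CondP6 P l →
      ∀ T : Cor22.ThetaVolumeDatumAt P l,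
        (letI := T.instFieldF; letI := T.instNumberFieldF; letI := T.instAlgebraF; letI := T.instFieldK
         letI := T.instNumberFieldK; letI := T.instAlgebraK; letI := T.instFieldFbar; letI := T.instAlgebraFbar
         letI := T.instAlgebraKFbar; letI := T.instIsElliptic
         ¬ (∀ p ∈ T.I.supportPrimes, ∀ v w : placesOver (fieldOfModuli T.E) p,
            (Summit.ABC.IUTFork.DHData.ofInput T.I).logQloc p v = (Summit.ABC.IUTFork.DHData.ofInput T.I).logQloc p w)) →
        T.HullEstimateOf
          (((l : ℝ) + 1) / 4 *
            ((1 + 12 * (Cor22.dmod P : ℝ) / l) * (P.logDiff + Cor22.logCondAvoid P {2, l})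
              + 2 * Real.log l + 52
              + 20 / 3 * Real.log (((2 ^ 12 * 3 ^ 3 * 5 * Cor22.dmod P : ℕ) : ℝ) * (l : ℝ))
                * (Nat.primeCounting (2 ^ 12 * 3 ^ 3 * 5 * Cor22.dmod P * l) : ℝ)))) :
    _root_.ABC := by
  refine Summit.ABC.ABC.Theorems.ThetaPartII.ABC_of_cor312_of_hullRegime (fun P₀ hP l hl h5 hc h2 h5' h6 => ?_) hreg
  intro T
  letI := T.instFieldF; letI := T.instNumberFieldF; letI := T.instFieldK; letI := T.instNumberFieldK
  letI := T.instAlgebraK; letI := T.instFieldFbar; letI := T.instAlgebraFbar; letI := T.instAlgebraKFbar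
  letI := T.instIsElliptic
  obtain ⟨X, M, _, _, archPk, archSub, Ψ, act, Mmod, region, frobAdm, frobLogvol, frobΨ, frobMmod, unitImage, ballImage,
    thetaDiv, n, HT, LogLink, IsFull, lat, Frd, IsoF, Ob, realify, Strip, IsoS, Mv, _, sig, split, ObΔ, N, _, qData, tq, t, ρ, qK,
    htq0, htq1, htq, ht0, ht1, hX, hSH, hQPin, hΘ⟩ := H P₀ hP l hl h5 hc h2 h5' h6 T
  exact cor312Of_of_SH_genuine_places T.D T.I X M archPk archSub Ψ act Mmod region frobAdm frobLogvol frobΨ frobMmod unitImage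
    ballImage thetaDiv n lat sig split qData tq t ρ qK htq0 htq1 htq ht0 ht1 T.isVolumeInputOf hX hSH hQPin hΘ

end Summit.ABC.IUTFork.Conditional

end
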